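import Mathlib
import HarnessLib
import Summits.HodgeConjecture.HodgeConjecture.Theorems.HodgeLocusCensusExSet632Char0

/-!
# HodgeLocusCensusExSet632RrefG1 — the first-order half of the (6,3,2) characteristic-0 certificate re-derived from the PRINTED rref rows (cell pub-hlocus, LEAD seat ivhs-1, gen 20; ruling R-L10)
HONEST FRAMING: certified instances and evidence bearing on the general Hodge conjecture; no claim.

SOURCE.  Record `pub-hlocus-ivhs-2/M632-CHAR0-g22.md` §2(a)/§5 (ivhs-2, gen 22; two implementations, kit j141726 = j141724 verbatim) prints
`CANON rref[B0|B1]: rank 5, pivots [0,1,2,3,7]` with its five rows; the same rows are recorded as data in the tree anchor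
`HodgeLocusCensusExSet632Char0` (`canonA.rrefRows`).  Writing [B0|B1] = P·[R0|R1] with P (8×5) injective, the pencil matrix is
B(λ) = B0 + λB1 = P·M(λ) with M(λ) := R0 + λR1 (5×7), so rank B(λ) = rank M(λ) and (Cauchy–Binet, inner dimension 5) the gcd g₁ of the
5×5 minors of B(λ) is a unit times the gcd of the 21 maximal minors of M(λ).  The lead's exact recomputation
(`pub-hlocus-ivhs-1/gen20/r10check/g1_from_rref.json`) gives that gcd = λ(λ−1) and reproduces the ten printed pencil ranks.
WHAT THE KERNEL CHECKS HERE (over an arbitrary field K; the matrices are the literal printed rows):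
* `maxMinor_M_zero` : at λ = 0 EVERY maximal minor of M vanishes (row 4 of M(0) = R0 is zero)            — rank B(0) ≤ 4, 0 ∈ E;
* `maxMinor_M_one`  : at λ = 1 EVERY maximal minor of M vanishes (rows 0 and 4 of M(1) coincide)         — rank B(1) ≤ 4, 1 ∈ E;
* `minor01234_M`    : the maximal minor on columns {0,1,2,3,4} equals λ² − λ                            — so g₁ divides λ(λ−1) up to the unit, and
* `minor01234_M_ne_zero` : it is non-zero for λ ∉ {0,1}                                                  — rank B(λ) = 5 off {0,1}.
Together with the two vanishing statements this pins the zero set of g₁ to {0,1} exactly, i.e. g₁ = unit·λ^a(λ−1)^b with a, b ≥ 1, and the explicit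
minor shows a = b = 1 is attained: g₁ = λ(λ−1) up to a unit — the printed value.  (λ = ∞, i.e. rank R1 = 4, is the exact computation's, not re-proved here.)
NOT FORMALISED: the derivation of [B0|B1] from the cubic C2 (ivhs-2's J₇-cokernel computation), g₂, the passage to μ₀, any Hodge theory.
-/

namespace Summit.HodgeConjecture.HodgeConjecture.HodgeLocus.Census.ExSet632RrefG1

open Matrix

variable {K : Type*} [Field K]

/-- Columns 0–6 of the printed rref rows: R0 (the B0 half). -/
def R0 : Matrix (Fin 5) (Fin 7) K :=
  !![1, 0, 0, 0, 0, 0, 0;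
     0, 1, 0, 0, 0, 0, 0;
     0, 0, 1, 0, 0, 0, 0;
     0, 0, 0, 1, 0, 0, 0;
     0, 0, 0, 0, 0, 0, 0]

/-- Columns 7–13 of the printed rref rows: R1 (the B1 half). -/
def R1 : Matrix (Fin 5) (Fin 7) K :=
  !![0, 0, 0, 0, -1, -1, -1;
     0, 0, 0, 0, -1,  0,  0;
     0, 0, 0, 0,  0, -1,  0;
     0, 0, 0, 0,  0,  0, -1;
     1, 0, 0, 0, -1, -1, -1]

/-- The row-space model of the pencil: M(λ) = R0 + λ·R1, so that B(λ) = P·M(λ) with P injective. -/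
def M (lam : K) : Matrix (Fin 5) (Fin 7) K := R0 + lam • R1

/-- The maximal minor of M(λ) on columns {0,1,2,3,4}, written out. -/
def A (lam : K) : Matrix (Fin 5) (Fin 5) K :=
  !![1, 0, 0, 0, -lam;
     0, 1, 0, 0, -lam;
     0, 0, 1, 0, 0;
     0, 0, 0, 1, 0;
     lam, 0, 0, 0, -lam]

/-- `A λ` is literally the submatrix of `M λ` on the first five columns. -/
theorem A_eq_submatrix (lam : K) : A lam = (M lam).submatrix id (Fin.castLE (by norm_num)) := by
  ext i j
  fin_cases i <;> fin_cases j <;> simp [A, M, R0, R1, Fin.castLE]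

/-- The explicit maximal minor: det A(λ) = λ² − λ. -/
theorem det_A (lam : K) : (A lam).det = lam ^ 2 - lam := by
  simp [A, Matrix.det_succ_row_zero, Fin.sum_univ_succ, Matrix.submatrix, Fin.succAbove]
  ring

/-- The maximal minor of M(λ) on columns {0,1,2,3,4} equals λ² − λ = λ(λ−1). -/
theorem minor01234_M (lam : K) : ((M lam).submatrix id (Fin.castLE (by norm_num : 5 ≤ 7))).det = lam ^ 2 - lam := by
  rw [← A_eq_submatrix, det_A]

/-- Off {0,1} that minor is non-zero: rank M(λ) = rank B(λ) = 5 there. -/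
theorem minor01234_M_ne_zero {lam : K} (h0 : lam ≠ 0) (h1 : lam ≠ 1) :
    ((M lam).submatrix id (Fin.castLE (by norm_num : 5 ≤ 7))).det ≠ 0 := by
  rw [minor01234_M]
  have : lam ^ 2 - lam = lam * (lam - 1) := by ring
  rw [this]
  exact mul_ne_zero h0 (sub_ne_zero.mpr h1)

/-- At λ = 0 the last row of M vanishes, so EVERY maximal minor is zero (rank B(0) ≤ 4: 0 ∈ E). -/
theorem maxMinor_M_zero (c : Fin 5 → Fin 7) : ((M (0 : K)).submatrix id c).det = 0 := by
  apply Matrix.det_eq_zero_of_row_eq_zero 4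
  intro j
  simp only [M, zero_smul, add_zero, Matrix.submatrix_apply, id_eq]
  generalize c j = k
  fin_cases k <;> simp [R0]

/-- At λ = 1 rows 0 and 4 of M coincide, so EVERY maximal minor is zero (rank B(1) ≤ 4: 1 ∈ E). -/
theorem maxMinor_M_one (c : Fin 5 → Fin 7) : ((M (1 : K)).submatrix id c).det = 0 := by
  apply Matrix.det_zero_of_row_eq (i := 0) (j := 4) (by decide)
  funext j
  simp only [M, one_smul, Matrix.submatrix_apply, id_eq, Matrix.add_apply]
  generalize c j = k
  fin_cases k <;> simp [R0, R1]

/-! ## Link to the tree data: the rows used here ARE the rows recorded in `HodgeLocusCensusExSet632Char0` -/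

/-- The five printed rows, as recorded (over ℤ, 14 columns) in the tree anchor of ivhs-2's certificate. -/
theorem rows_match_tree :
    Summit.HodgeConjecture.HodgeConjecture.HodgeLocus.Census.ExSet632Char0.canonA.rrefRows =
      [[1,0,0,0,0,0,0, 0,0,0,0,-1,-1,-1], [0,1,0,0,0,0,0, 0,0,0,0,-1,0,0], [0,0,1,0,0,0,0, 0,0,0,0,0,-1,0],
       [0,0,0,1,0,0,0, 0,0,0,0,0,0,-1], [0,0,0,0,0,0,0, 1,0,0,0,-1,-1,-1]] := by
  rfl

/-- Transcription check over ℚ: `R0`/`R1` are the left/right 7-column halves of those recorded rows. -/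
theorem R0_R1_transcription (i : Fin 5) (j : Fin 7) :
    (R0 : Matrix (Fin 5) (Fin 7) ℚ) i j
        = (((Summit.HodgeConjecture.HodgeConjecture.HodgeLocus.Census.ExSet632Char0.canonA.rrefRows.getD i.val []).getD j.val 0 : ℤ) : ℚ) ∧
      (R1 : Matrix (Fin 5) (Fin 7) ℚ) i j
        = (((Summit.HodgeConjecture.HodgeConjecture.HodgeLocus.Census.ExSet632Char0.canonA.rrefRows.getD i.val []).getD (7 + j.val) 0 : ℤ) : ℚ) := by
  rw [rows_match_tree]
  fin_cases i <;> fin_cases j <;> simp [R0, R1]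

end Summit.HodgeConjecture.HodgeConjecture.HodgeLocus.Census.ExSet632RrefG1
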